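import Literature.NumberTheory.GaloisCohomology.Howard2004.RingClassConjugationStableProofs
import Literature.NumberTheory.GaloisCohomology.Howard2004.InertLocalTauUnramifiedProofs
import Literature.NumberTheory.GaloisCohomology.Howard2004.TowerMorphism
import HarnessLib

/-!
# Howard 2004, §1.3 / Lemma 1.5.3: conjugation by `τ` carries `H¹_tr(K_λ̄, T)` onto `H¹_tr(K_λ, Tw T)`;
# the local `τ_q` at an inert Kolyvagin prime preserves the transverse condition (proofs file)

Topic `NumberTheory/GaloisCohomology/Howard2004` (the transverse twin of `TransportUnramified` /
`InertLocalTauUnramifiedProofs`; sequel to `RingClassConjugationStableProofs`).  THEOREMS ONLY: no definition,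
no named fact, no instance, no notation, no `sorry`.

B. Howard, *The Heegner point Kolyvagin system*, Compositio Math. 140 (2004) = arXiv:1202.6340: §1.3 p. 7 L44–48
«conjugation by `τ` induces an isomorphism `H¹(K_v̄, T) ≅ H¹(K_v, Tw(T))`», H.5(b) p. 7 L96–97 «the condition `𝓕`
propagated to `T̄` is stable under the action of `G_ℚ`», applied in Lemma 1.5.3 (p. 10 L12–16) to `𝓕 = 𝓕(n)`, whose
component at `λ ∣ n` is the TRANSVERSE condition `H¹_tr(K_λ, ·)` (Def. 1.2.2): complex conjugation must act on
`H¹_tr(K_λ, T̄)`.  In the tree `H¹_tr(K_λ, T) = ker (H¹(K_λ, T) → H¹(Γ_L, T))` for Howard's `Γ_L = transverseFixer`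
(generated by the `σ ∈ Γ_{K_λ}` with a prime-to-`p` power in `Γ_{K_λ} ∩ Γ_{K[ℓ]}`), and the local transport
`φ_λ : Γ_{K_λ} → Γ_{K_λ̄}` of a conjugation datum maps `Γ_L(λ)` ONTO `Γ_L(λ̄)`
(`ConjugationDatum.φ_mem_transverseFixer_iff`, from «`K[ℓ]/ℚ` is Galois»).  Hence, with NO hypothesis on the
local action (contrast `TransverseIsotropyProofs.ConjugationDatum.transportH1_mem_transverseCondition`, which reads
`H¹_tr` through cocycles killing `Γ_{K_λ} ∩ Γ_{K[ℓ]}` and needs trivial local actions and `p`-primary `T`):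

* §1 `resSubgroup_cohomologyMap_eq_zero` — `H¹(f)` of an equivariant additive map carries classes vanishing on a
  subgroup `H ≤ Γ_F` to classes vanishing on `H` (cocycles principal on `H` stay principal; the tree's
  `TowerMorphismPushforward.cohomologyMap_mem_transverseCondition` is the case of a GLOBALLY equivariant map); the
  cocycle criterion `oneCocycleClass_mem_transverseCondition_iff_exists` (`[φ] ∈ H¹_tr ↔ φ` principal on `Γ_L`, no
  hypothesis on the action) and **`ResidualTau.thetaH1_mem_transverseCondition`** (`θ_*` carries
  `H¹_tr(K_v, Tw T̄)` into `H¹_tr(K_v, T̄)`).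
* §2 **`ConjugationDatum.map_transportH1_transverseCondition_le / _eq`** — `transport_v (H¹_tr(K_v̄, T)) = H¹_tr(K_v, Tw T)`
  for EVERY conjugation datum, every discrete `T`, `K` imaginary quadratic, `ℓ ≠ 0` (cocycle `h ↦ δ_v c(φ_v h)`;
  inverse through the continuous inverse of `φ_v`, `exists_continuous_inverse_phi`); membership form
  `ConjugationDatum.transportH1_mem_transverseCondition_of_isImaginaryQuadratic`.
* §3 at an INERT `q` (`h : cd.σ • q = q`, the currency of `InertLocalTauProofs`): `cast_mem_transverseCondition_iff'`
  and **`ResidualTau.thetaH1_transportH1_cast_mem_transverseCondition`** — `x ∈ H¹_tr(K_q, T̄) ⟹ τ_q x ∈ H¹_tr(K_q, T̄)`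
  for `τ_q x := θ_* (transport_q (h.symm ▸ x))`: the letter «`Lt` is `τ_q`-stable» of the Lemma 1.5.3 (DICH) recipe
  (seat x10b-p1-w5 g7's open input), unconditionally in the datum.

Cell `pub/bsd-print-x9`, G87 = Howard 2004 Thm. 1.6.1 (print leaf `stub_h161` of stmt-BirchSwinnertonDyer-22642);
seat `bsd-line-x10b-p1-w6` g9, brick (TR-STAB).  BSD is not proved by any of this.

References: [Howard2004HeegnerKolyvagin] §1.2–§1.3, H.5(b), Lemma 1.5.3 (arXiv:1202.6340 p. 6 L84–95, p. 7 L44–48,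
L96–97, p. 10 L12–16); [SerreGaloisCohomology1997] I §2.4, I §5.1; [Cox2013] §9.A Lemma 9.3.
-/

set_option autoImplicit false

noncomputable section

open Function NumberField IsDedekindDomain Field
open scoped NumberField Classical

namespace Literature.NumberTheory.GaloisCohomology.Howard2004

open Literature.NumberTheory.GaloisRepresentations Literature.NumberTheory.GaloisRepresentations.DiscreteGaloisModule
open Literature.NumberTheory.EllipticCurves

/-! ## §1 `H¹(f)` and `θ_*` preserve the classes vanishing on a subgroup, in particular `H¹_tr` -/

section Map

variable {F : Type} [Field F] {M₁ : Type} [AddCommGroup M₁] [TopologicalSpace M₁] [DiscreteTopology M₁]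
  {M₂ : Type} [AddCommGroup M₂] [TopologicalSpace M₂] [DiscreteTopology M₂]

/-- **`H¹(f)` preserves the classes vanishing on a subgroup**: for an additive `Γ_F`-equivariant `f : M₁ → M₂`,
`H ≤ Γ_F` and `x ∈ H¹(F, M₁)` with `res_H x = 0`, also `res_H (H¹(f) x) = 0` (a cocycle principal on `H`,
`c(h) = h m − m`, maps to `h ↦ h (f m) − f m`). [cite: SerreGaloisCohomology1997, Ch. I §5.1 and §2.2] -/
theorem resSubgroup_cohomologyMap_eq_zero (τ₁ : DiscreteGaloisModule F M₁) (τ₂ : DiscreteGaloisModule F M₂)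
    (f : M₁ →+ M₂) (hf : ∀ (g : absoluteGaloisGroup F) (x : M₁), f (τ₁ g x) = τ₂ g (f x))
    (H : Subgroup (absoluteGaloisGroup F)) {x : galoisCohomology τ₁ 1}
    (hx : resSubgroup τ₁.toTopRep H 1 x = 0) :
    resSubgroup τ₂.toTopRep H 1
      (ContinuousRep.cohomologyMap τ₁ τ₂ f continuous_of_discreteTopology hf 1 x) = 0 := by
  obtain ⟨c, rfl⟩ := oneCocycleClass_surjective τ₁.toTopRep x
  obtain ⟨m, hm⟩ := (resSubgroup_oneCocycleClass_eq_zero_iff τ₁.toTopRep H c).1 hx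
  rw [cohomologyMap_one_oneCocycleClass]
  refine (resSubgroup_oneCocycleClass_eq_zero_iff τ₂.toTopRep H _).2 ⟨f m, fun h hh => ?_⟩
  change f (c.1 h) = τ₂ h (f m) - f m
  rw [hm h hh]
  change f (τ₁ h m - m) = τ₂ h (f m) - f m
  rw [map_sub, hf]

variable {K : Type} [Field K] [NumberField K] {M : Type} [AddCommGroup M] [TopologicalSpace M]
  [DiscreteTopology M]

/-- **`[φ] ∈ H¹_tr(K_λ, M)` iff `φ` is principal on `Γ_L`**: `∃ w, ∀ τ ∈ Γ_L, φ τ = τ w − w` (no hypothesis on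
the action; the trivial-action form is `TransverseCartesianProofs.oneCocycleClass_mem_transverseCondition_iff`).
[cite: Howard2004HeegnerKolyvagin, §1.1 transverse condition and §1.2 (arXiv p. 5 L52–56, p. 6 L84–95)] [cite: SerreGaloisCohomology1997, Ch. I §5.1] -/
theorem oneCocycleClass_mem_transverseCondition_iff_exists {p : ℕ} [Fact p.Prime] (ρ : DiscreteGaloisModule K M)
    (ℓ : ℕ) (jbar : AlgebraicClosure K →+* ℂ) (v : HeightOneSpectrum (𝓞 K))
    (φ : contOneCocycles (DiscreteGaloisModule.toTopRep (GaloisRep.toLocal v ρ))) :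
    oneCocycleClass _ φ ∈ transverseCondition p ρ ℓ jbar v ↔
      ∃ w : M, ∀ τ ∈ transverseFixer p ℓ jbar v, φ.1 τ = GaloisRep.toLocal v ρ τ w - w :=
  Iff.trans Iff.rfl (resSubgroup_oneCocycleClass_eq_zero_iff
    (DiscreteGaloisModule.toTopRep (GaloisRep.toLocal v ρ)) (transverseFixer p ℓ jbar v) φ)

end Map

variable {K : Type} [Field K] [NumberField K]

namespace ResidualTau

variable {Nbar : Type} [AddCommGroup Nbar] [TopologicalSpace Nbar] [DiscreteTopology Nbar] {R : Type}
  [CommRing R] [Module R Nbar] {cd : ConjugationDatum K} {ρbar : DiscreteGaloisModule K Nbar}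

/-- **`θ_*` carries `H¹_tr(K_v, Tw T̄)` into `H¹_tr(K_v, T̄)`** (`θ : Tw(T̄) → T̄` is an equivariant module map over
`Γ_{K_v}`). [cite: Howard2004HeegnerKolyvagin, H.5(a)–(b) (arXiv p. 7 L93–97) and Lemma 1.5.3 (p. 10 L12–16)] -/
theorem thetaH1_mem_transverseCondition {p : ℕ} [Fact p.Prime] (A : ResidualTau (R := R) cd ρbar) (ℓ : ℕ)
    (jbar : AlgebraicClosure K →+* ℂ) (v : HeightOneSpectrum (𝓞 K))
    {y : galoisCohomology ((cd.twist ρbar).toLocal (Sum.inr v)) 1}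
    (hy : y ∈ transverseCondition p (cd.twist ρbar) ℓ jbar v) :
    A.thetaH1 (Sum.inr v) y ∈ transverseCondition p ρbar ℓ jbar v :=
  resSubgroup_cohomologyMap_eq_zero (GaloisRep.toLocal v (cd.twist ρbar)) (GaloisRep.toLocal v ρbar)
    A.θ.toAddMonoidHom (fun _ x => A.compat _ x) (transverseFixer p ℓ jbar v) hy

end ResidualTau

/-! ## §2 `transport_v (H¹_tr(K_v̄, T)) = H¹_tr(K_v, Tw T)` for every conjugation datum -/

namespace ConjugationDatum

variable {M : Type} [AddCommGroup M] [TopologicalSpace M] [DiscreteTopology M]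

/-- **`transportH1 (H¹_tr(K_v̄, T)) ≤ H¹_tr(K_v, Tw T)`** (`K` imaginary quadratic, `ℓ ≠ 0`, ANY conjugation datum and
ANY discrete `T`): a cocycle `c` principal on `Γ_L(v̄)`, `c(g) = g m − m`, transports to `h ↦ δ_v c(φ_v h)`, which on
`Γ_L(v)` — mapped into `Γ_L(v̄)` by `φ_v` (`φ_mem_transverseFixer`) — equals `h ↦ h·(δ_v m) − δ_v m` for the twisted
action. [cite: Howard2004HeegnerKolyvagin, §1.3 (arXiv p. 7 L44–48) with §1.2 (p. 6 L84–95)] [cite: Cox2013, §9.A Lemma 9.3] -/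
theorem map_transportH1_transverseCondition_le {p : ℕ} [Fact p.Prime] (cd : ConjugationDatum K)
    (hK : IsImaginaryQuadratic K) (ρ : DiscreteGaloisModule K M) (jbar : AlgebraicClosure K →+* ℂ) {ℓ : ℕ}
    (hℓ : ℓ ≠ 0) (v : HeightOneSpectrum (𝓞 K)) :
    (transverseCondition p ρ ℓ jbar (cd.σ • v)).map (cd.transportH1 ρ v) ≤
      transverseCondition p (cd.twist ρ) ℓ jbar v := by
  rintro _ ⟨x, hx, rfl⟩
  obtain ⟨c, rfl⟩ := oneCocycleClass_surjective _ x
  obtain ⟨m, hm⟩ :=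
    (oneCocycleClass_mem_transverseCondition_iff_exists (p := p) ρ ℓ jbar (cd.σ • v) c).mp hx
  change cd.transportH1 ρ v (oneCocycleClass _ c) ∈ transverseCondition p (cd.twist ρ) ℓ jbar v
  rw [transportH1_oneCocycleClass]
  refine (oneCocycleClass_mem_transverseCondition_iff_exists (p := p) (cd.twist ρ) ℓ jbar v _).mpr
    ⟨ρ (cd.δ v) m, fun τ hτ => ?_⟩
  rw [contOneCocycles.pullback_apply, hm _ (cd.φ_mem_transverseFixer hK jbar hℓ v hτ), transportHom_hom_apply]
  -- `τ⁻¹ res_v(τ') τ` acts on `δ m` as `δ res_v̄(φ τ')` acts on `m`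
  have aux : ρ.toRepresentation (cd.conj (absGaloisRestrict K (v.adicCompletion K) τ)) (ρ.toRepresentation (cd.δ v) m) =
      ρ.toRepresentation (cd.δ v)
        (ρ.toRepresentation (absGaloisRestrict K ((cd.σ • v).adicCompletion K) (cd.φ v τ)) m) := by
    rw [cd.conj_absGaloisRestrict_eq v τ, map_mul, map_mul, Module.End.mul_apply, Module.End.mul_apply,
      ← Module.End.mul_apply (f := ρ.toRepresentation (cd.δ v)⁻¹), ← map_mul, inv_mul_cancel, map_one,
      Module.End.one_apply]
  change ρ.toRepresentation (cd.δ v)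
      (ρ.toRepresentation (absGaloisRestrict K ((cd.σ • v).adicCompletion K) (cd.φ v τ)) m - m) =
    ρ.toRepresentation (cd.conj (absGaloisRestrict K (v.adicCompletion K) τ)) (ρ.toRepresentation (cd.δ v) m) -
      ρ.toRepresentation (cd.δ v) m
  rw [map_sub, aux]

/-- Membership form: `y' ∈ H¹_tr(K_{σ v}, T) ⟹ transport_v y' ∈ H¹_tr(K_v, Tw T)` — the conclusion of
`TransverseIsotropyProofs.ConjugationDatum.transportH1_mem_transverseCondition` WITHOUT its hypotheses on the local
action (`htriv'`, `htrivTw`, `hp`, `hφ`), for `K` imaginary quadratic and `ℓ ≠ 0`.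
[cite: Howard2004HeegnerKolyvagin, §1.3 (arXiv p. 7 L44–48) with §1.2 (p. 6 L84–95)] -/
theorem transportH1_mem_transverseCondition_of_isImaginaryQuadratic {p : ℕ} [Fact p.Prime]
    (cd : ConjugationDatum K) (hK : IsImaginaryQuadratic K) (ρ : DiscreteGaloisModule K M)
    (jbar : AlgebraicClosure K →+* ℂ) {ℓ : ℕ} (hℓ : ℓ ≠ 0) (v : HeightOneSpectrum (𝓞 K))
    {y' : galoisCohomology (ρ.toLocal (Sum.inr (cd.σ • v))) 1}
    (hy' : y' ∈ transverseCondition p ρ ℓ jbar (cd.σ • v)) :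
    cd.transportH1 ρ v y' ∈ transverseCondition p (cd.twist ρ) ℓ jbar v :=
  cd.map_transportH1_transverseCondition_le hK ρ jbar hℓ v ⟨y', hy', rfl⟩

/-- **`transportH1 (H¹_tr(K_v̄, T)) = H¹_tr(K_v, Tw T)`** (`K` imaginary quadratic, `ℓ ≠ 0`, ANY conjugation datum).
For `⊇`, a cocycle `d` of `Tw T` on `Γ_{K_v}` is the transport of `g ↦ δ_v⁻¹ d(φ_v⁻¹ g)` (`φ_v` is a continuous
bijection of compact groups, hence a homeomorphism), which is principal on `Γ_L(v̄)` when `d` is principal on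
`Γ_L(v)` (`φ_v⁻¹` maps `Γ_L(v̄)` into `Γ_L(v)`, `φ_mem_transverseFixer_iff`).
[cite: Howard2004HeegnerKolyvagin, §1.3 (arXiv p. 7 L44–48) with §1.2 (p. 6 L84–95) and H.5(b) (p. 7 L96–97)] [cite: Cox2013, §9.A Lemma 9.3] -/
theorem map_transportH1_transverseCondition_eq {p : ℕ} [Fact p.Prime] (cd : ConjugationDatum K)
    (hK : IsImaginaryQuadratic K) (ρ : DiscreteGaloisModule K M) (jbar : AlgebraicClosure K →+* ℂ) {ℓ : ℕ}
    (hℓ : ℓ ≠ 0) (v : HeightOneSpectrum (𝓞 K)) :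
    (transverseCondition p ρ ℓ jbar (cd.σ • v)).map (cd.transportH1 ρ v) =
      transverseCondition p (cd.twist ρ) ℓ jbar v := by
  refine le_antisymm (cd.map_transportH1_transverseCondition_le hK ρ jbar hℓ v) fun y hy => ?_
  -- read `y` in the `K_v = v.adicCompletion K` form of the local module (definitionally the same type)
  change galoisCohomology (GaloisRep.toLocal v (cd.twist ρ)) 1 at y
  obtain ⟨d, rfl⟩ := oneCocycleClass_surjective (GaloisRep.toLocal v (cd.twist ρ)).toTopRep y
  obtain ⟨w, hw⟩ :=
    (oneCocycleClass_mem_transverseCondition_iff_exists (p := p) (cd.twist ρ) ℓ jbar v d).mp hy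
  -- `ψ = φ_v⁻¹`, continuous and multiplicative
  obtain ⟨ψ, hφψ, hψφ, hmul⟩ := cd.exists_continuous_inverse_phi v
  -- the key commutation: `δ⁻¹ (τ⁻¹ res_v(ψ g) τ) = res_v̄(g) δ⁻¹`
  have key : ∀ g : absoluteGaloisGroup ((cd.σ • v).adicCompletion K),
      (cd.δ v)⁻¹ * cd.conj (absGaloisRestrict K (v.adicCompletion K) (ψ g)) =
        absGaloisRestrict K ((cd.σ • v).adicCompletion K) g * (cd.δ v)⁻¹ := fun g => by
    rw [cd.conj_absGaloisRestrict_eq v (ψ g), hφψ]; group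
  have hcomm : ∀ (g : absoluteGaloisGroup ((cd.σ • v).adicCompletion K)) (y : M),
      ρ.toRepresentation (cd.δ v)⁻¹ (ρ.toRepresentation (cd.conj (absGaloisRestrict K (v.adicCompletion K) (ψ g))) y) =
        ρ.toRepresentation (absGaloisRestrict K ((cd.σ • v).adicCompletion K) g) (ρ.toRepresentation (cd.δ v)⁻¹ y) :=
    fun g y => by
      rw [← Module.End.mul_apply, ← map_mul, key, map_mul, Module.End.mul_apply]
  -- the cocycle `c(g) = δ_v⁻¹ · d(ψ g)` of `T` on `Γ_{K_v̄}`: transverse, and transporting to `d`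
  obtain ⟨c, hc_tr, hc_eq⟩ : ∃ c : contOneCocycles (GaloisRep.toLocal (cd.σ • v) ρ).toTopRep,
      oneCocycleClass _ c ∈ transverseCondition p ρ ℓ jbar (cd.σ • v) ∧
        contOneCocycles.pullback (cd.φ v) (cd.transportHom ρ v) c = d := by
    refine ⟨⟨⟨fun g => ρ (cd.δ v)⁻¹ (d.1 (ψ g)),
        continuous_of_discreteTopology.comp (d.1.continuous.comp ψ.continuous)⟩, fun g g' => ?_⟩, ?_, ?_⟩
    · -- cocycle identity
      change ρ.toRepresentation (cd.δ v)⁻¹ (d.1 (ψ (g * g'))) =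
        ρ.toRepresentation (cd.δ v)⁻¹ (d.1 (ψ g)) +
          ρ.toRepresentation (absGaloisRestrict K ((cd.σ • v).adicCompletion K) g)
            (ρ.toRepresentation (cd.δ v)⁻¹ (d.1 (ψ g')))
      rw [hmul, d.2 (ψ g) (ψ g')]
      change ρ.toRepresentation (cd.δ v)⁻¹ (d.1 (ψ g) +
          ρ.toRepresentation (cd.conj (absGaloisRestrict K (v.adicCompletion K) (ψ g))) (d.1 (ψ g'))) = _
      rw [map_add, hcomm]
    · -- transverse at `v̄`
      refine (oneCocycleClass_mem_transverseCondition_iff_exists (p := p) ρ ℓ jbar (cd.σ • v) _).mpr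
        ⟨ρ (cd.δ v)⁻¹ w, fun τ hτ => ?_⟩
      have hτ' : ψ τ ∈ transverseFixer p ℓ jbar v :=
        (cd.φ_mem_transverseFixer_iff hK jbar hℓ v (ψ τ)).1 (by rw [hφψ]; exact hτ)
      change ρ.toRepresentation (cd.δ v)⁻¹ (d.1 (ψ τ)) =
        ρ.toRepresentation (absGaloisRestrict K ((cd.σ • v).adicCompletion K) τ) (ρ.toRepresentation (cd.δ v)⁻¹ w) -
          ρ.toRepresentation (cd.δ v)⁻¹ w
      rw [hw _ hτ']
      change ρ.toRepresentation (cd.δ v)⁻¹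
          (ρ.toRepresentation (cd.conj (absGaloisRestrict K (v.adicCompletion K) (ψ τ))) w - w) = _
      rw [map_sub, hcomm]
    · -- transports to `d`
      refine Subtype.ext (ContinuousMap.ext fun h => ?_)
      change ρ.toRepresentation (cd.δ v) (ρ.toRepresentation (cd.δ v)⁻¹ (d.1 (ψ (cd.φ v h)))) = d.1 h
      rw [hψφ, ← Module.End.mul_apply, ← map_mul, mul_inv_cancel, map_one, Module.End.one_apply]
  refine ⟨oneCocycleClass _ c, hc_tr, ?_⟩
  rw [transportH1_oneCocycleClass, hc_eq]
  rfl

end ConjugationDatum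

/-! ## §3 At an inert `q`: `τ_q` preserves `H¹_tr(K_q, T̄)` -/

/-- The place cast along `v = w` preserves `H¹_tr`. [cite: Howard2004HeegnerKolyvagin, §1.3 (arXiv p. 7 L44–48, read at `λ̄ = λ`)] -/
theorem cast_mem_transverseCondition_iff' {p : ℕ} [Fact p.Prime] {M : Type} [AddCommGroup M]
    [TopologicalSpace M] [DiscreteTopology M] (ρ : DiscreteGaloisModule K M) (ℓ : ℕ)
    (jbar : AlgebraicClosure K →+* ℂ) {v w : HeightOneSpectrum (𝓞 K)} (h : v = w)
    (x : galoisCohomology (ρ.toLocal (Sum.inr v)) 1) :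
    (h ▸ x : galoisCohomology (ρ.toLocal (Sum.inr w)) 1) ∈ transverseCondition p ρ ℓ jbar w ↔
      x ∈ transverseCondition p ρ ℓ jbar v := by
  subst h
  exact Iff.rfl

namespace ResidualTau

variable {Nbar : Type} [AddCommGroup Nbar] [TopologicalSpace Nbar] [DiscreteTopology Nbar] {R : Type}
  [CommRing R] [Module R Nbar] {cd : ConjugationDatum K} {ρbar : DiscreteGaloisModule K Nbar}

/-- **`τ_q` preserves the transverse condition at an inert prime** (`K` imaginary quadratic, `ℓ ≠ 0`,
`h : σ • q = q`, ANY conjugation datum): `x ∈ H¹_tr(K_q, T̄) ⟹ θ_* (transport_q (h.symm ▸ x)) ∈ H¹_tr(K_q, T̄)` —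
«complex conjugation acts on `H¹_{𝓕(n)}(K_λ, T̄) = H¹_tr`», the letter «`Lt` is `τ_q`-stable» of the Lemma 1.5.3
dichotomy. [cite: Howard2004HeegnerKolyvagin, H.5(b) (arXiv p. 7 L96–97) and Lemma 1.5.3 (p. 10 L12–16) with §1.3 (p. 7 L44–48)] -/
theorem thetaH1_transportH1_cast_mem_transverseCondition {p : ℕ} [Fact p.Prime]
    (A : ResidualTau (R := R) cd ρbar) (hK : IsImaginaryQuadratic K) (jbar : AlgebraicClosure K →+* ℂ)
    {ℓ : ℕ} (hℓ : ℓ ≠ 0) {q : HeightOneSpectrum (𝓞 K)} (h : cd.σ • q = q)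
    {x : galoisCohomology (ρbar.toLocal (Sum.inr q)) 1} (hx : x ∈ transverseCondition p ρbar ℓ jbar q) :
    A.thetaH1 (Sum.inr q) (cd.transportH1 ρbar q
        (h.symm ▸ x : galoisCohomology (ρbar.toLocal (Sum.inr (cd.σ • q))) 1)) ∈
      transverseCondition p ρbar ℓ jbar q :=
  A.thetaH1_mem_transverseCondition ℓ jbar q
    (cd.transportH1_mem_transverseCondition_of_isImaginaryQuadratic hK ρbar jbar hℓ q
      ((cast_mem_transverseCondition_iff' ρbar ℓ jbar h.symm x).2 hx))

end ResidualTau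

end Literature.NumberTheory.GaloisCohomology.Howard2004

end
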